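import Summits.CriticalPhenomena.PercolationContinuityZ3.Theorems.PercNearOneGluingNoHeavyPcintMemPad
import Summits.CriticalPhenomena.PercolationContinuityZ3.Theorems.PercNearOneGluingNoHeavyPcintClosingCountKernel
import HarnessLib

/-!
# CriticalPhenomena/PercolationContinuityZ3 — Theorems/PercNearOneGluingNoHeavyPcintMemUniform.lean: the memory-`τ` class automaton is UNIFORM IN THE DIMENSION — one dimension-4 row list simulates `mstep τ` on `ℤ^d` for every `d ≥ 4`

Lane prim-pcint, STRUCTURE rule (prim-pcint-2 GEN 18), part 2 of the transfer principle (part 1: …PcintMemPad — padding and fresh axes).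
The tree certifies memory growth constants `μ_τ(ℤ^d)` one dimension at a time (`SCertOK` / `SCertLowOK`, rows = dangerous sets
modulo the `2^d d!` lattice symmetries).  For the memory-6 automaton every reachable dangerous set is supported on at most THREE
coordinate axes, so its symmetry classes and the class-to-class letter counts are the same in every dimension `d ≥ 4`, except that the
`±` pair of letters on a FRESH axis occurs `d − 3` times instead of once.  Here:

* `uistep L d` — the index automaton on the rows of a dimension-4 list `L : List (SCertRow 4)` over the alphabet of `ℤ^d`: letters on
  axes `< 4` act as recorded, letters on axes `≥ 4` act like axis `3`;
* `UStruct τ L` — the structural conjuncts of `SCertOK` (so every landed dimension-4 certificate supplies it: `ustruct_of_scertOK`);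
  `USupp L` — every row state vanishes on axis `3` (decidable);
* `mstep_padState_low` / `mstep_padState_high` — reading a letter of `ℤ^d` from a padded row state;
* `uistep_some` / `uistep_none` — the successor data; **`cnt_mstep_eq_cnt_uistep`**: for `d ≥ 4`, `UStruct τ L` and `USupp L`,
  the memory-`τ` counts of `ℤ^d` from `∅` ARE the accepted-word counts of `uistep L d` from row `0` (`cnt_eq_of_simulation_upto` of
  …PcintMemCertSym with the padded rows); `cntP_eq_of_simulation_upto`, `hasAge_padState`, **`cntP_mstep_eq_cntP_uistep`** — the same
  with the final-state predicate "age `j` present" of …PcintClosingCountKernel (so the exact closing counts `2τ·p_τ(ℤ^d)` of ALL `d`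
  are counts of the one dimension-4 list).
The companion …PcintMemUniformBounds turns this into `λ ≤ μ_τ(ℤ^d) ≤ λ'` for all `d ≥ 4` from row inequalities affine in `d`.

HONEST FRAMING: Pönitz–Tittmann's symmetry-reduced automaton read uniformly in `d`; elementary.  No `sorry`; standard axioms.
Written by prim-pcint-2 gen 18 (prover-prim-pcint-2-g18-0), 2026-08-26.

## References
* A. Pönitz, P. Tittmann, *Improved upper bounds for self-avoiding walks in ℤ^d*, Electron. J. Combin. 7 (2000) R21, §3 [PonitzTittmann2000].
* N. Madras, G. Slade, *The Self-Avoiding Walk*, Birkhäuser 1993, §1.2 (1.2.12)–(1.2.14) [MadrasSlade1993].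
-/

noncomputable section

open Literature.Probability.Percolation Literature.Probability.LatticeModels

namespace Summit.CriticalPhenomena.PercolationContinuityZ3.Theorems.Pcint

/-! ### The uniform index automaton of a dimension-4 row list -/

section Uniform

variable {d : ℕ}

/-- The index automaton of a dimension-4 row list read in dimension `d`: letters on axes `< 4` act as recorded, letters on
axes `≥ 4` act like the corresponding letter on axis `3`. [folklore] -/
def uistep (L : List (SCertRow 4)) (d : ℕ) (i : ℕ) (a : Fin d × Bool) : Option ℕ :=
  if h : (a.1 : ℕ) < 4 then sistep L i (⟨a.1, h⟩, a.2) else sistep L i ((3 : Fin 4), a.2)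

/-- Structural validity of a row list (the structural conjuncts of `SCertOK`): row `0` is `∅`, every recorded successor is the
true `mstep` successor up to the recorded symmetry, indices are in range. [folklore] -/
def UStruct (τ : ℕ) (L : List (SCertRow 4)) : Prop :=
  0 < L.length ∧ sstOf L 0 = ∅ ∧
    ∀ i < L.length, ∀ a : Fin 4 × Bool,
      mstep τ (sstOf L i) a = (ssucc L i a).map (fun p => smulState p.2 (sstOf L p.1)) ∧
        ∀ p ∈ ssucc L i a, p.1 < L.length

/-- Every valid certificate modulo symmetry is structurally valid. [folklore] -/
theorem ustruct_of_scertOK {τ num den m : ℕ} {L : List (SCertRow 4)} (h : SCertOK τ num den m L) : UStruct τ L :=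
  ⟨h.1, h.2.1, fun i hi => (h.2.2 i hi).1⟩

/-- Support condition: every row state vanishes on axis `3` (so axis `3` is fresh for every row). Decidable. [folklore] -/
def USupp (L : List (SCertRow 4)) : Prop := ∀ i < L.length, ∀ q ∈ sstOf L i, q.1 (3 : Fin 4) = 0

/-- `USupp` is decidable. [folklore] -/
instance (L : List (SCertRow 4)) : Decidable (USupp L) := by
  unfold USupp; infer_instance

/-- A padded row state vanishes on every axis `≥ 3` of `ℤ^d`. [folklore] -/
theorem padState_row_apply {L : List (SCertRow 4)} (hS : USupp L) {i : ℕ} (hi : i < L.length)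
    {q : Site d × ℕ} (hq : q ∈ padState d (sstOf L i)) {v : Fin d} (hv : 3 ≤ (v : ℕ)) : q.1 v = 0 := by
  obtain ⟨r, hr, hqr⟩ := (mem_padState _ q).1 hq
  rw [hqr]
  by_cases hv4 : (v : ℕ) < 4
  · rw [padSite_apply_lt r hv4]
    have h3 : (⟨v, hv4⟩ : Fin 4) = 3 := by ext; simp; omega
    rw [h3]; exact hS i hi (r, q.2) hr
  · exact padSite_apply_ge r (Nat.not_lt.1 hv4)

/-- Reading a letter on an axis `≥ 4` from a padded row state = reading axis `3`, then a transposition. [folklore] -/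
theorem mstep_padState_high (τ : ℕ) (hd : 4 ≤ d) {L : List (SCertRow 4)} (hS : USupp L) {i : ℕ} (hi : i < L.length)
    (a : Fin d × Bool) (ha : ¬ (a.1 : ℕ) < 4) :
    mstep τ (padState d (sstOf L i)) a =
      ((mstep τ (sstOf L i) ((3 : Fin 4), a.2)).map (padState d)).map
        (smulState (swapPerm (Fin.castLE hd 3) a.1)) := by
  rcases a with ⟨v, b⟩
  have hv3 : 3 ≤ (v : ℕ) := by simp only [not_lt] at ha; omega
  have hfresh : ∀ q ∈ padState d (sstOf L i), q.1 (Fin.castLE hd 3) = 0 ∧ q.1 v = 0 := fun q hq =>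
    ⟨padState_row_apply hS hi hq (by simp), padState_row_apply hS hi hq hv3⟩
  rw [mstep_fresh τ (Fin.castLE hd 3) v b hfresh]
  have : ((Fin.castLE hd (3 : Fin 4), b) : Fin d × Bool) = padLetter hd ((3 : Fin 4), b) := rfl
  rw [this, mstep_pad]

/-- Reading a letter on an axis `< 4` from a padded row state = padding the dimension-4 successor. [folklore] -/
theorem mstep_padState_low (τ : ℕ) (hd : 4 ≤ d) (L : List (SCertRow 4)) (i : ℕ) (a : Fin d × Bool)
    (ha : (a.1 : ℕ) < 4) :
    mstep τ (padState d (sstOf L i)) a = (mstep τ (sstOf L i) (⟨a.1, ha⟩, a.2)).map (padState d) := by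
  conv_lhs => rw [← padLetter_mk hd a ha]
  rw [mstep_pad]

/-- Successor data of the uniform index automaton: an accepted letter of `ℤ^d` leads to a row `j` in range, and the true
successor of the padded row state is the padded row-`j` state up to a symmetry of `ℤ⁴` and a symmetry of `ℤ^d`. [folklore] -/
theorem uistep_some {τ : ℕ} {L : List (SCertRow 4)} (hd : 4 ≤ d) (hU : UStruct τ L) (hS : USupp L) {i : ℕ}
    (hi : i < L.length) {a : Fin d × Bool} {j : ℕ} (hij : uistep L d i a = some j) :
    j < L.length ∧ ∃ g : SPerm 4, ∃ G : SPerm d,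
      mstep τ (padState d (sstOf L i)) a = some (smulState G (padState d (smulState g (sstOf L j)))) := by
  obtain ⟨-, -, hrows⟩ := hU
  unfold uistep at hij
  by_cases ha : (a.1 : ℕ) < 4
  · rw [dif_pos ha] at hij
    unfold sistep at hij
    cases hs : ssucc L i (⟨a.1, ha⟩, a.2) with
    | none => rw [hs] at hij; exact absurd hij (by simp)
    | some p =>
      rw [hs, Option.map_some] at hij
      simp only [Option.some.injEq] at hij
      have hj : p.1 < L.length := (hrows i hi (⟨a.1, ha⟩, a.2)).2 p (by rw [hs]; simp)
      refine ⟨hij ▸ hj, p.2, ⟨Equiv.refl _, fun _ => true⟩, ?_⟩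
      have he := (hrows i hi (⟨a.1, ha⟩, a.2)).1
      rw [mstep_padState_low τ hd L i a ha, he, hs, Option.map_some, Option.map_some, ← hij]
      congr 1
      ext ⟨x, m⟩
      rw [mem_smulState]
      constructor
      · intro hx; exact ⟨x, hx, by ext i; simp [smulSite]⟩
      · rintro ⟨r, hr, hxr⟩
        have hx : x = smulSite ((Equiv.refl (Fin d), fun _ => true) : SPerm d) r := hxr
        have : x = r := by rw [hx]; ext i; simp [smulSite]
        rw [this]; exact hr
  · rw [dif_neg ha] at hij
    unfold sistep at hij
    cases hs : ssucc L i ((3 : Fin 4), a.2) with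
    | none => rw [hs] at hij; exact absurd hij (by simp)
    | some p =>
      rw [hs, Option.map_some] at hij
      simp only [Option.some.injEq] at hij
      have hj : p.1 < L.length := (hrows i hi ((3 : Fin 4), a.2)).2 p (by rw [hs]; simp)
      refine ⟨hij ▸ hj, p.2, swapPerm (Fin.castLE hd 3) a.1, ?_⟩
      have he := (hrows i hi ((3 : Fin 4), a.2)).1
      rw [mstep_padState_high τ hd hS hi a ha, he, hs, Option.map_some, Option.map_some, Option.map_some, ← hij]

/-- A rejected letter of the uniform index automaton is rejected by `mstep` from the padded row state. [folklore] -/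
theorem uistep_none {τ : ℕ} {L : List (SCertRow 4)} (hd : 4 ≤ d) (hU : UStruct τ L) (hS : USupp L) {i : ℕ}
    (hi : i < L.length) {a : Fin d × Bool} (hia : uistep L d i a = none) :
    mstep τ (padState d (sstOf L i)) a = none := by
  obtain ⟨-, -, hrows⟩ := hU
  unfold uistep at hia
  by_cases ha : (a.1 : ℕ) < 4
  · rw [dif_pos ha] at hia
    unfold sistep at hia
    have he := (hrows i hi (⟨a.1, ha⟩, a.2)).1
    cases hs : ssucc L i (⟨a.1, ha⟩, a.2) with
    | none =>
      rw [hs, Option.map_none] at he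
      rw [mstep_padState_low τ hd L i a ha, he]; rfl
    | some p => rw [hs] at hia; exact absurd hia (by simp)
  · rw [dif_neg ha] at hia
    unfold sistep at hia
    have he := (hrows i hi ((3 : Fin 4), a.2)).1
    cases hs : ssucc L i ((3 : Fin 4), a.2) with
    | none =>
      rw [hs, Option.map_none] at he
      rw [mstep_padState_high τ hd hS hi a ha, he]; rfl
    | some p => rw [hs] at hia; exact absurd hia (by simp)

/-- **Uniformity in the dimension**: for `d ≥ 4` the memory-`τ` counts of `ℤ^d` are the accepted-word counts of the uniform
index automaton of any structurally valid dimension-4 row list whose rows vanish on axis `3`.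
[cite: PonitzTittmann2000, §3 (symmetry-reduced automata)] -/
theorem cnt_mstep_eq_cnt_uistep {τ : ℕ} {L : List (SCertRow 4)} (hd : 4 ≤ d) (hU : UStruct τ L) (hS : USupp L)
    (n : ℕ) : cnt (mstep τ) (∅ : MState d) n = cnt (uistep L d) 0 n := by
  have h0 := hU.1
  have hst0 := hU.2.1
  set R : Set ℕ := {i | i < L.length} with hRdef
  have hR : ∀ i ∈ R, ∀ a j, uistep L d i a = some j → j ∈ R := fun i hi a j hij =>
    (uistep_some hd hU hS hi hij).1
  have hnone : ∀ i ∈ R, ∀ a, uistep L d i a = none → mstep τ (padState d (sstOf L i)) a = none :=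
    fun i hi a hia => uistep_none hd hU hS hi hia
  have hsome : ∀ i ∈ R, ∀ a j, uistep L d i a = some j →
      ∃ T, mstep τ (padState d (sstOf L i)) a = some T ∧
        ∀ n, cnt (mstep τ) T n = cnt (mstep τ) (padState d (sstOf L j)) n := by
    intro i hi a j hij
    obtain ⟨-, g, G, hG⟩ := uistep_some hd hU hS hi hij
    refine ⟨_, hG, fun n => ?_⟩
    rw [cnt_smulState, ← smulState_padPerm hd, cnt_smulState]
  have h1 := cnt_eq_of_simulation_upto (mstep τ) (uistep L d) (fun i => padState d (sstOf L i)) R hR hnone hsome n 0 h0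
  simpa [hst0] using h1

/-! ### The same with a final-state predicate (exact closing counts) -/

/-- A simulation up to count-preserving replacement of successor states preserves counts with a compatible final-state
predicate. [folklore] -/
theorem cntP_eq_of_simulation_upto {σ σ' α : Type*} [Fintype α] (step : σ → α → Option σ)
    (step' : σ' → α → Option σ') (f : σ' → σ) (R : Set σ') (P : σ → Prop) [DecidablePred P]
    (P' : σ' → Prop) [DecidablePred P'] (hP : ∀ i ∈ R, (P (f i) ↔ P' i))
    (hR : ∀ i ∈ R, ∀ a j, step' i a = some j → j ∈ R)
    (hnone : ∀ i ∈ R, ∀ a, step' i a = none → step (f i) a = none)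
    (hsome : ∀ i ∈ R, ∀ a j, step' i a = some j →
      ∃ T, step (f i) a = some T ∧ ∀ n, cntP step P T n = cntP step P (f j) n) :
    ∀ (n : ℕ), ∀ i ∈ R, cntP step P (f i) n = cntP step' P' i n := by
  intro n
  induction n with
  | zero => intro i hi; simp [cntP, hP i hi]
  | succ n ih =>
    intro i hi
    simp only [cntP]
    refine Finset.sum_congr rfl fun a _ => ?_
    cases hia : step' i a with
    | none => rw [hnone i hi a hia]
    | some j =>
      obtain ⟨T, hT, hcnt⟩ := hsome i hi a j hia
      rw [hT]
      exact (hcnt n).trans (ih j (hR i hi a j hia))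

/-- Padding does not touch ages. [folklore] -/
theorem hasAge_padState {k : ℕ} (j : ℕ) (S : MState k) : HasAge j (padState d S) ↔ HasAge j S := by
  constructor
  · rintro ⟨q, hq, hqj⟩
    obtain ⟨r, hr, -⟩ := (mem_padState S q).1 hq
    exact ⟨(r, q.2), hr, hqj⟩
  · rintro ⟨q, hq, hqj⟩
    exact ⟨(padSite d q.1, q.2), (mem_padState S _).2 ⟨q.1, hq, rfl⟩, hqj⟩

/-- **Uniformity in the dimension, with the age predicate**: for `d ≥ 4` the number of memory-`τ` words of `ℤ^d` whose final
dangerous set has an entry of age `j` is the corresponding count of the uniform index automaton (predicate read on the row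
states). [cite: PonitzTittmann2000, §3] -/
theorem cntP_mstep_eq_cntP_uistep {τ : ℕ} {L : List (SCertRow 4)} (hd : 4 ≤ d) (hU : UStruct τ L) (hS : USupp L)
    (j n : ℕ) :
    cntP (mstep τ) (HasAge j) (∅ : MState d) n = cntP (uistep L d) (fun i => HasAge j (sstOf L i)) 0 n := by
  have h0 := hU.1
  have hst0 := hU.2.1
  set R : Set ℕ := {i | i < L.length} with hRdef
  have hR : ∀ i ∈ R, ∀ a j, uistep L d i a = some j → j ∈ R := fun i hi a j hij =>
    (uistep_some hd hU hS hi hij).1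
  have hnone : ∀ i ∈ R, ∀ a, uistep L d i a = none → mstep τ (padState d (sstOf L i)) a = none :=
    fun i hi a hia => uistep_none hd hU hS hi hia
  have hsome : ∀ i ∈ R, ∀ a j', uistep L d i a = some j' →
      ∃ T, mstep τ (padState d (sstOf L i)) a = some T ∧
        ∀ n, cntP (mstep τ) (HasAge j) T n = cntP (mstep τ) (HasAge j) (padState d (sstOf L j')) n := by
    intro i hi a j' hij
    obtain ⟨-, g, G, hG⟩ := uistep_some hd hU hS hi hij
    refine ⟨_, hG, fun n => ?_⟩
    rw [cntP_hasAge_smulState, ← smulState_padPerm hd, cntP_hasAge_smulState]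
  have hP : ∀ i ∈ R, (HasAge j (padState d (sstOf L i)) ↔ HasAge j (sstOf L i)) := fun i _ => hasAge_padState j _
  have h1 := cntP_eq_of_simulation_upto (mstep τ) (uistep L d) (fun i => padState d (sstOf L i)) R (HasAge j)
    (fun i => HasAge j (sstOf L i)) hP hR hnone hsome n 0 h0
  simpa [hst0] using h1

end Uniform

end Summit.CriticalPhenomena.PercolationContinuityZ3.Theorems.Pcint
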